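import Literature.NumberTheory.QuadraticFields.GaussianPrimary
import Literature.NumberTheory.LFunctions.GaussianThetaSeries
import Mathlib.NumberTheory.ArithmeticFunction.Misc
import Mathlib.Data.Nat.Factorization.Induction
import HarnessLib

/-!
# Counting Gaussian integers of given norm: `r(n) ≤ 4 τ(n)`, and the number of Gaussian divisors

Topic `Literature/NumberTheory/QuadraticFields`, extending `GaussianPrimary` (same namespace).
Everything here is PROVED (Mathlib + the tree's `GaussianPrimary`).

* `gaussBox X` — the lattice points `z = r + is` with `|r|, |s| ≤ X` (`(2X+1)²` of them);
* `normEq n` — all `z ∈ ℤ[i]` with `N(z) = n`, so `#(normEq n) = r(n) = r₂(n)`: this is the tree's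
  `Literature.NumberTheory.LFunctions.GaussianTheta.normEq` (`GaussianThetaSeries`), reused, not redefined;
* `card_primaryNormEq_le_card_divisors` — the number of **primary** `z` with `N(z) = n` is at most
  `τ(n)` (`n ≥ 1`): sub-multiplicative over coprime factorisations (the map `(y, z) ↦ y z` is onto,
  as in the tree's `primarySum_mul_of_coprime`) and `≤ k + 1` on prime powers `p^k` (the tree's
  explicit descriptions `primaryNormEq_pow_of_mod_four_eq_one/three`, `∅` for `p = 2`);
* `card_normEq_le` — **`r(n) ≤ 4 τ(n)`** for `n ≥ 1` (Hardy–Wright Thm 278 gives the exact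
  `r(n) = 4 (d₁(n) - d₃(n))`; we only need the bound): for odd `n` every `z` is a unit times its
  primary associate, and `z ↦ z/(1+i)` injects `normEq (2n)` into `normEq n`;
* `card_filter_dvd_le` — a nonzero `z ∈ ℤ[i]` has at most `4 τ(N z)²` divisors in any finite set
  (a divisor has norm dividing `N z`).

These are the "divisor function in `ℤ[i]`" inputs of Friedlander–Iwaniec §21 ((21.8): the pairs
`m₁ m₂ = □` weighted by `τ`; the bound `β̃_z ≪ N^ε` in the Hölder step before (21.9)).

## References

* G. H. Hardy, E. M. Wright, *An Introduction to the Theory of Numbers*, 6th ed. (2008), Thm 278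
  (`r(n) = 4 Σ_{d ∣ n, d odd} (-1)^{(d-1)/2}`), §16.9–16.10 — for orientation only; not used.
* K. Ireland, M. Rosen, *A Classical Introduction to Modern Number Theory*, 2nd ed., Ch. 9 §7
  (primary Gaussian integers), as in `GaussianPrimary`.
-/

noncomputable section

open Finset

namespace Literature.NumberTheory.QuadraticFields

namespace GaussianPrimary

local notation "ℤ[i]" => GaussianInt

open Zsqrtd

/-! ### Boxes and the sets `N(z) = n` -/

/-- The lattice box `{r + is : |r| ≤ X, |s| ≤ X}`. [folklore] -/
def gaussBox (X : ℕ) : Finset ℤ[i] :=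
  ((Icc (-(X : ℤ)) X) ×ˢ (Icc (-(X : ℤ)) X)).image fun p : ℤ × ℤ ↦ (⟨p.1, p.2⟩ : ℤ[i])

/-- Membership in the box. [folklore] -/
theorem mem_gaussBox {X : ℕ} {z : ℤ[i]} : z ∈ gaussBox X ↔ |z.re| ≤ X ∧ |z.im| ≤ X := by
  simp only [gaussBox, mem_image, mem_product, mem_Icc, abs_le, Prod.exists]
  constructor
  · rintro ⟨a, b, ⟨⟨h1, h2⟩, h3, h4⟩, rfl⟩
    exact ⟨⟨h1, h2⟩, h3, h4⟩
  · rintro ⟨⟨h1, h2⟩, h3, h4⟩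
    exact ⟨z.re, z.im, ⟨⟨h1, h2⟩, h3, h4⟩, rfl⟩

/-- The box has `(2X+1)²` points. [folklore] -/
theorem card_gaussBox (X : ℕ) : #(gaussBox X) = (2 * X + 1) ^ 2 := by
  rw [gaussBox, card_image_of_injective _ (fun p q h => by
    simp only [Zsqrtd.mk.injEq] at h; exact Prod.ext h.1 h.2), card_product, Int.card_Icc]
  have : ((X : ℤ) + 1 - -(X : ℤ)).toNat = 2 * X + 1 := by omega
  rw [this]; ring

/-- Boxes are monotone. [folklore] -/
theorem gaussBox_mono {X Y : ℕ} (h : X ≤ Y) : gaussBox X ⊆ gaussBox Y := by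
  intro z hz
  rw [mem_gaussBox] at hz ⊢
  exact ⟨hz.1.trans (by exact_mod_cast h), hz.2.trans (by exact_mod_cast h)⟩

/-- `|re z| ≤ N(z)` and `|im z| ≤ N(z)`. [folklore] -/
theorem abs_re_le_norm (z : ℤ[i]) : |z.re| ≤ z.norm ∧ |z.im| ≤ z.norm := by
  have e : z.norm = z.re ^ 2 + z.im ^ 2 := by rw [Zsqrtd.norm_def]; ring
  rw [e, Int.abs_eq_natAbs, Int.abs_eq_natAbs]
  exact ⟨by nlinarith [Int.natAbs_le_self_sq z.re, sq_nonneg z.im],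
    by nlinarith [Int.natAbs_le_self_sq z.im, sq_nonneg z.re]⟩

/-- A Gaussian integer of norm at most `n` lies in the box of half-side `n`. [folklore] -/
theorem mem_gaussBox_of_norm_le {n : ℕ} {z : ℤ[i]} (h : z.norm ≤ n) : z ∈ gaussBox n :=
  mem_gaussBox.mpr ⟨(abs_re_le_norm z).1.trans h, (abs_re_le_norm z).2.trans h⟩

open Literature.NumberTheory.LFunctions.GaussianTheta (normEq mem_normEq)

/-- `normEq n ⊆ gaussBox n`. [folklore] -/
theorem normEq_subset_gaussBox (n : ℕ) : normEq n ⊆ gaussBox n := fun _ hz ↦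
  mem_gaussBox_of_norm_le (mem_normEq.mp hz).le

/-- Primary elements of norm `n` are among all elements of norm `n`. [folklore] -/
theorem primaryNormEq_subset_normEq (n : ℕ) : primaryNormEq n ⊆ normEq n := fun _ hz ↦
  mem_normEq.mpr (mem_primaryNormEq.mp hz).1

/-! ### Primary elements of norm `n`: at most `τ(n)` -/

/-- A primary element of norm `k` divides `k`. [folklore] -/
theorem dvd_natCast_of_norm_eq {y : ℤ[i]} {k : ℕ} (hy : y.norm = k) : y ∣ (k : ℤ[i]) := by
  have := self_dvd_norm y
  rwa [hy, Int.cast_natCast] at this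

/-- **Sub-multiplicativity**: for coprime `m, m'`, every primary `x` with `N(x) = m m'` is a product
`y z` of primary `y, z` with `N(y) = m`, `N(z) = m'` (`y ~ gcd(x, m)`, `z ~ gcd(x, m')`), so
`#primaryNormEq (m m') ≤ #primaryNormEq m · #primaryNormEq m'`. (The map is in fact a bijection —
the tree's `primarySum_mul_of_coprime`; only surjectivity is needed here.) [folklore] -/
theorem card_primaryNormEq_mul_le {m m' : ℕ} (h : m.Coprime m') :
    #(primaryNormEq (m * m')) ≤ #(primaryNormEq m) * #(primaryNormEq m') := by
  rw [← card_product]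
  refine card_le_card_of_surjOn (fun p ↦ p.1 * p.2) ?_
  intro x hx
  obtain ⟨hxn, hxp⟩ := mem_primaryNormEq.mp (mem_coe.mp hx)
  have hcop : IsCoprime (m : ℤ[i]) (m' : ℤ[i]) := isCoprime_natCast h
  have hm0 : m ≠ 0 := by
    rintro rfl
    rw [zero_mul, Nat.cast_zero, GaussianInt.norm_eq_zero] at hxn
    exact hxp.ne_zero hxn
  have hm0' : m' ≠ 0 := by
    rintro rfl
    rw [mul_zero, Nat.cast_zero, GaussianInt.norm_eq_zero] at hxn
    exact hxp.ne_zero hxn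
  set g := EuclideanDomain.gcd x (m : ℤ[i]) with hg
  set g' := EuclideanDomain.gcd x (m' : ℤ[i]) with hg'
  have hgx : g ∣ x := EuclideanDomain.gcd_dvd_left _ _
  have hgm : g ∣ (m : ℤ[i]) := EuclideanDomain.gcd_dvd_right _ _
  have hg'x : g' ∣ x := EuclideanDomain.gcd_dvd_left _ _
  have hg'm : g' ∣ (m' : ℤ[i]) := EuclideanDomain.gcd_dvd_right _ _
  have hcg : IsCoprime g g' := (hcop.of_isCoprime_of_dvd_left hgm).of_isCoprime_of_dvd_right hg'm
  have h1 : g * g' ∣ x := hcg.mul_dvd hgx hg'x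
  have hxmm : x ∣ (m : ℤ[i]) * m' := by
    have := dvd_natCast_of_norm_eq hxn
    rwa [Nat.cast_mul] at this
  have h2 : x ∣ g * g' := by
    rw [hg, hg', EuclideanDomain.gcd_eq_gcd_ab x (m : ℤ[i]), EuclideanDomain.gcd_eq_gcd_ab x (m' : ℤ[i])]
    set a := EuclideanDomain.gcdA x (m : ℤ[i])
    set b := EuclideanDomain.gcdB x (m : ℤ[i])
    set a' := EuclideanDomain.gcdA x (m' : ℤ[i])
    set b' := EuclideanDomain.gcdB x (m' : ℤ[i])
    have : (x * a + (m : ℤ[i]) * b) * (x * a' + (m' : ℤ[i]) * b') =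
        x * (a * (x * a' + (m' : ℤ[i]) * b') + (m : ℤ[i]) * b * a') + (m : ℤ[i]) * m' * (b * b') := by
      ring
    rw [this]
    exact dvd_add (dvd_mul_right _ _) (hxmm.mul_right _)
  have hassoc : Associated x (g * g') := associated_of_dvd_dvd h2 h1
  -- parities: `g`, `g'` are odd since their norms divide the odd `N(x)`
  have hodd_of_dvd : ∀ {c : ℤ[i]}, c ∣ x → (c.re + c.im) % 2 = 1 := by
    intro c hc
    have h3 := norm_dvd_norm hc
    rw [← norm_emod_two]
    have hx2 : x.norm % 2 = 1 := hxp.norm_odd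
    rcases Int.emod_two_eq_zero_or_one c.norm with h0 | h0
    · exfalso
      obtain ⟨e, he⟩ := h3
      rw [he, Int.mul_emod, h0] at hx2
      simp at hx2
    · exact h0
  have hgodd := hodd_of_dvd hgx
  have hg'odd := hodd_of_dvd hg'x
  -- norms: `N(g) ∣ m`, `N(g') ∣ m'`, `N(g) N(g') = m m'`
  have hnorm_dvd : ∀ {c : ℤ[i]} {k : ℕ}, c ∣ (k : ℤ[i]) → c ∣ x → (k ∣ m * m') →
      c.norm.natAbs ∣ k * k ∧ c.norm.natAbs ∣ m * m' := by
    intro c k hck hcx _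
    constructor
    · have := norm_dvd_norm hck
      rw [Zsqrtd.norm_natCast] at this
      exact Int.natAbs_dvd_natAbs.mpr this |>.trans (by simp [Int.natAbs_mul])
    · have := norm_dvd_norm hcx
      rw [hxn] at this
      have := Int.natAbs_dvd_natAbs.mpr this
      rwa [Int.natAbs_natCast] at this
  have hng : g.norm.natAbs ∣ m := by
    obtain ⟨h3, h4⟩ := hnorm_dvd hgm hgx (dvd_mul_right m m')
    have h5 := Nat.dvd_gcd h3 h4
    rwa [Nat.gcd_mul_left, h.gcd_eq_one, mul_one] at h5
  have hng' : g'.norm.natAbs ∣ m' := by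
    obtain ⟨h3, h4⟩ := hnorm_dvd hg'm hg'x (dvd_mul_left m' m)
    have h5 := Nat.dvd_gcd h4 h3
    rwa [Nat.gcd_mul_right, h.gcd_eq_one, one_mul] at h5
  have hN : g.norm.natAbs * g'.norm.natAbs = m * m' := by
    obtain ⟨u, hu⟩ := hassoc
    have := congrArg Zsqrtd.norm hu
    rw [Zsqrtd.norm_mul, Zsqrtd.norm_mul, (Zsqrtd.norm_eq_one_iff' (by norm_num) _).mpr u.isUnit,
      mul_one, hxn] at this
    have := congrArg Int.natAbs this
    rwa [Int.natAbs_mul, Int.natAbs_natCast, eq_comm] at this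
  obtain ⟨hgm_eq, hg'm_eq⟩ := eq_of_dvd_of_mul_eq hng hng' hN hm0 hm0'
  refine ⟨(primary g, primary g'), ?_, ?_⟩
  · rw [mem_coe, mem_product]
    refine ⟨mem_primaryNormEq.mpr ⟨?_, isPrimary_primary hgodd⟩,
      mem_primaryNormEq.mpr ⟨?_, isPrimary_primary hg'odd⟩⟩
    · rw [norm_primary hgodd, ← hgm_eq, Int.natAbs_of_nonneg (GaussianInt.norm_nonneg g)]
    · rw [norm_primary hg'odd, ← hg'm_eq, Int.natAbs_of_nonneg (GaussianInt.norm_nonneg g')]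
  · simp only
    rw [← primary_mul, ← primary_eq_primary_of_associated hassoc, primary_of_isPrimary hxp]

/-- On prime powers: `#primaryNormEq (p^k) ≤ k + 1`. [folklore] -/
theorem card_primaryNormEq_prime_pow_le {p : ℕ} (hp : p.Prime) (k : ℕ) :
    #(primaryNormEq (p ^ k)) ≤ k + 1 := by
  haveI := Fact.mk hp
  have h4 : p % 4 = 1 ∨ p % 4 = 3 ∨ p = 2 := by
    have := hp.eq_two_or_odd; omega
  rcases h4 with h1 | h3 | rfl
  · obtain ⟨π, hπ, hπn⟩ := exists_isPrimary_norm_eq h1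
    rw [primaryNormEq_pow_of_mod_four_eq_one hp hπ hπn k]
    exact card_image_le.trans (by rw [card_range])
  · obtain ⟨j, rfl | rfl⟩ := Nat.even_or_odd' k
    · rw [(primaryNormEq_pow_of_mod_four_eq_three h3 j).1, card_singleton]; omega
    · rw [(primaryNormEq_pow_of_mod_four_eq_three h3 j).2, card_empty]; omega
  · rcases k with _ | k
    · rw [pow_zero, primaryNormEq_one, card_singleton]
    · rw [primaryNormEq_eq_empty_of_even (dvd_pow_self 2 (Nat.succ_ne_zero k)), card_empty]; omega

/-- **The number of primary `z` with `N(z) = n` is at most `τ(n)`** (`n ≥ 1`). [folklore] -/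
theorem card_primaryNormEq_le_card_divisors : ∀ n : ℕ, n ≠ 0 → #(primaryNormEq n) ≤ #n.divisors := by
  intro n
  induction n using Nat.recOnPosPrimePosCoprime with
  | prime_pow p k hp hk =>
    intro _
    calc #(primaryNormEq (p ^ k)) ≤ k + 1 := card_primaryNormEq_prime_pow_le hp k
      _ = #(p ^ k).divisors := by rw [Nat.divisors_prime_pow hp, card_map, card_range]
  | zero => intro h; exact absurd rfl h
  | one => intro _; rw [primaryNormEq_one, Nat.divisors_one]; rfl
  | coprime a b ha hb hab iha ihb =>
    intro _
    calc #(primaryNormEq (a * b)) ≤ #(primaryNormEq a) * #(primaryNormEq b) := card_primaryNormEq_mul_le hab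
      _ ≤ #a.divisors * #b.divisors := Nat.mul_le_mul (iha (by omega)) (ihb (by omega))
      _ = #(a * b).divisors := (Nat.Coprime.card_divisors_mul hab).symm

/-! ### All elements of norm `n`: `r(n) ≤ 4 τ(n)` -/

/-- For odd `n`, every `z` with `N(z) = n` is a unit times its primary associate, so
`r(n) ≤ 4 · #primaryNormEq n`. [folklore] -/
theorem card_normEq_le_four_mul_of_odd {n : ℕ} (hn : Odd n) : #(normEq n) ≤ 4 * #(primaryNormEq n) := by
  classical
  have hpar : ∀ z ∈ normEq n, (z.re + z.im) % 2 = 1 := by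
    intro z hz
    rw [← norm_emod_two, mem_normEq.mp hz]
    exact_mod_cast Nat.odd_iff.mp hn
  have hmaps : ∀ z ∈ normEq n, primary z ∈ primaryNormEq n := fun z hz ↦
    mem_primaryNormEq.mpr ⟨by rw [norm_primary (hpar z hz), mem_normEq.mp hz], isPrimary_primary (hpar z hz)⟩
  refine card_le_mul_card_image_of_maps_to hmaps 4 fun a _ ↦ ?_
  -- the fibre over `a` is contained in `{a, -a, i a, -i a}`
  have hsub : (normEq n).filter (fun z ↦ primary z = a) ⊆
      ({a, -a, (⟨0, 1⟩ : ℤ[i]) * a, -((⟨0, 1⟩ : ℤ[i]) * a)} : Finset ℤ[i]) := by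
    intro z hz
    rw [mem_filter] at hz
    obtain ⟨hz, rfl⟩ := hz
    obtain ⟨u, hu, hux⟩ := exists_isUnit_primary_eq (hpar z hz)
    simp only [mem_insert, mem_singleton]
    rcases eq_of_isUnit hu with rfl | rfl | rfl | rfl
    · left; rw [hux, one_mul]
    · right; left; rw [hux]; ring
    · right; right; right; rw [hux, ← mul_assoc]
      have : (⟨0, 1⟩ : ℤ[i]) * ⟨0, 1⟩ = -1 := by ext <;> simp [Zsqrtd.re_mul, Zsqrtd.im_mul]
      rw [this]; ring
    · right; right; left; rw [hux, ← mul_assoc]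
      have : (⟨0, 1⟩ : ℤ[i]) * ⟨0, -1⟩ = 1 := by ext <;> simp [Zsqrtd.re_mul, Zsqrtd.im_mul]
      rw [this, one_mul]
  exact (card_le_card hsub).trans card_le_four

/-- `z ↦ z / (1 + i)` injects `normEq (2n)` into `normEq n`, so `r(2n) ≤ r(n)`. [folklore] -/
theorem card_normEq_two_mul_le (n : ℕ) : #(normEq (2 * n)) ≤ #(normEq n) := by
  -- for `N(z)` even, `re z ≡ im z (mod 2)` and `z/(1+i) = ((re+im)/2, (im-re)/2)`
  refine card_le_card_of_injOn (fun z ↦ (⟨(z.re + z.im) / 2, (z.im - z.re) / 2⟩ : ℤ[i])) ?_ ?_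
  · intro z hz
    have hzn := mem_normEq.mp (mem_coe.mp hz)
    have hpar : (z.re + z.im) % 2 = 0 := by rw [← norm_emod_two, hzn]; push_cast; omega
    obtain ⟨a, ha⟩ : ∃ a, z.re + z.im = 2 * a := ⟨(z.re + z.im) / 2, by omega⟩
    obtain ⟨b, hb⟩ : ∃ b, z.im - z.re = 2 * b := ⟨(z.im - z.re) / 2, by omega⟩
    refine mem_coe.mpr (mem_normEq.mpr ?_)
    have e : z.norm = z.re ^ 2 + z.im ^ 2 := by rw [Zsqrtd.norm_def]; ring
    dsimp only
    rw [ha, hb, Zsqrtd.norm_def]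
    simp only [Int.mul_ediv_cancel_left _ (two_ne_zero)]
    have hre : z.re = a - b := by omega
    have him : z.im = a + b := by omega
    rw [hre, him] at e
    rw [hzn] at e
    push_cast at e
    nlinarith [e]
  · intro z hz z' hz' h
    simp only [Zsqrtd.mk.injEq] at h
    have hzn := mem_normEq.mp (mem_coe.mp hz)
    have hzn' := mem_normEq.mp (mem_coe.mp hz')
    have hpar : (z.re + z.im) % 2 = 0 := by rw [← norm_emod_two, hzn]; push_cast; omega
    have hpar' : (z'.re + z'.im) % 2 = 0 := by rw [← norm_emod_two, hzn']; push_cast; omega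
    ext <;> omega

/-- **`r(n) ≤ 4 τ(n)`**: the number of Gaussian integers of norm `n ≥ 1` is at most four times the
number of divisors of `n`. [folklore] -/
theorem card_normEq_le : ∀ n : ℕ, n ≠ 0 → #(normEq n) ≤ 4 * #n.divisors := by
  intro n
  induction n using Nat.strong_induction_on with
  | _ n ih =>
    intro hn
    rcases Nat.even_or_odd n with ⟨m, rfl⟩ | hodd
    · have hm : m ≠ 0 := by omega
      rw [← two_mul]
      calc #(normEq (2 * m)) ≤ #(normEq m) := card_normEq_two_mul_le m
        _ ≤ 4 * #m.divisors := ih m (by omega) hm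
        _ ≤ 4 * #(2 * m).divisors :=
          Nat.mul_le_mul_left 4 (card_le_card (Nat.divisors_subset_of_dvd (by omega) (dvd_mul_left m 2)))
    · exact (card_normEq_le_four_mul_of_odd hodd).trans
        (Nat.mul_le_mul_left 4 (card_primaryNormEq_le_card_divisors n hn))

/-! ### Divisors of a Gaussian integer -/

/-- **A nonzero Gaussian integer has at most `4 τ(N z)²` divisors** in any finite set: a divisor `w`
has `N(w) ∣ N(z)`, and there are at most `4 τ(N w) ≤ 4 τ(N z)` elements of each such norm. [folklore] -/
theorem card_filter_dvd_le {z : ℤ[i]} (hz : z ≠ 0) (s : Finset ℤ[i]) [DecidablePred (· ∣ z)] :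
    #(s.filter (· ∣ z)) ≤ 4 * #(z.norm.natAbs.divisors) ^ 2 := by
  classical
  have hNz : z.norm.natAbs ≠ 0 := by
    rw [Ne, Int.natAbs_eq_zero, GaussianInt.norm_eq_zero]; exact hz
  have hsub : s.filter (· ∣ z) ⊆ (z.norm.natAbs.divisors).biUnion fun m ↦ normEq m := by
    intro w hw
    rw [mem_filter] at hw
    rw [mem_biUnion]
    refine ⟨w.norm.natAbs, Nat.mem_divisors.mpr ⟨Int.natAbs_dvd_natAbs.mpr (norm_dvd_norm hw.2), hNz⟩,
      mem_normEq.mpr (Int.natAbs_of_nonneg (GaussianInt.norm_nonneg w)).symm⟩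
  calc #(s.filter (· ∣ z)) ≤ #((z.norm.natAbs.divisors).biUnion fun m ↦ normEq m) := card_le_card hsub
    _ ≤ ∑ m ∈ z.norm.natAbs.divisors, #(normEq m) := card_biUnion_le
    _ ≤ ∑ m ∈ z.norm.natAbs.divisors, 4 * #(z.norm.natAbs.divisors) := by
        refine sum_le_sum fun m hm ↦ ?_
        have hm0 : m ≠ 0 := Nat.ne_of_gt (Nat.pos_of_mem_divisors hm)
        exact (card_normEq_le m hm0).trans
          (Nat.mul_le_mul_left 4 (card_le_card (Nat.divisors_subset_of_dvd hNz (Nat.dvd_of_mem_divisors hm))))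
    _ = 4 * #(z.norm.natAbs.divisors) ^ 2 := by rw [sum_const, smul_eq_mul]; ring

end GaussianPrimary

end Literature.NumberTheory.QuadraticFields

end
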